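import Summits.ABC.StewartYu.PadicG3KStep
import Summits.ABC.StewartYu.MonomialDenominators
import Summits.ABC.StewartYu.DescentLiouvilleQ
import HarnessLib

/-!
# Cell abc-stewartyu, crux `Y07Odd` (stmt-ABC-19658), line `gen3-slab-odd`: the rational values of the class family cleared and bounded,
# the Liouville inequality at the integer points, and THE k-STEP `g3_kstep`

`Summits/ABC/StewartYu/PadicG3ValuesGen.lean` — sequel to `PadicG3KStep` (cell `abc-stewartyu`, seat p2-g4, F-odd lead).  Theorems on
`G3Setup` for the GENERIC family `(R, v)` of `PadicG3Functions` (the `(ℓ₀, λ)`-indexed instance with Fel'dman weights is `PadicG3Values`);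
no named fact.  Odd-`p` twin of p3-g5's `PadicG3TwoValues` tail + `PadicG3TwoKStep.g3_kstep`, reusing the place-free `MonomialDen`.

* `boxExpG`, `exists_int_monDen_mul_prod` — `monDen(α, D·|x|)·∏ⱼ αⱼ^{vⱼx} ∈ ℤ`, `|·| ≤ monDen²` in the box `|vⱼ| ≤ Dⱼ`;
* `bj₀_pow_mul_zγpow`, `abs_prod_𝔛_pow_le` — `b_{j₀}^{|t|}·zγpow = ∏ 𝔛ₖ^{tₖ} ∈ ℤ`, `|·| ≤ Xb^{|t|}`;
* `exists_int_clear_mul_coef`, `exists_int_clear_mul_g3φ` — `D·g3φ τ x ∈ ℤ`, `|·| ≤ #B·P·M₀·Xb^{|t|}·monDen²`, `D = den₀·|b_{j₀}|^{|t|}·monDen`;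
* **`g3φ_eq_zero_of_norm_lt`** — `‖g3φ τ x‖_p < 1/K`, `K ≥ #B·P·M₀·Xb^{|t|}·monDen²` ⇒ `g3φ τ x = 0` (product formula);
* **`g3_kstep`** — zeros at `|x| ≤ N` for `|τ''| < Tlo` + the slab extrapolation bound `< 1/K` at the new points `|x₁| ≤ N'` ⇒ zeros
  at `|x₁| ≤ N'` for `|τ| + t ≤ Tlo`.

WHAT THIS IS NOT: no parameters (the record chooses `N, N', Tlo, t, Bw, K`); no Kummer descent; no crux moves.

References: Yu. V. Nesterenko, LNM 1819 (2003) §3.2, §4.3; K. Yu, Acta Math. 211 (2013), (5.35)–(5.41), Lemma 5.2.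
-/

noncomputable section

open Finset Polynomial
open Literature.NumberTheory.Transcendental
open Literature.NumberTheory.Transcendental.PadicCW77 (condExp)
open Literature.NumberTheory.Transcendental.CW77.Setup (Tau tauNorm)
open scoped Nat

namespace Summit.ABC.StewartYu

namespace G3Setup

variable {p : ℕ} [Fact p.Prime] (S : G3Setup p) {ι : Type*} (R : ι → ℚ[X]) (v : ι → Fin S.n → ℤ)

/-! ### The monomial cleared -/

/-- The exponent box at the point `x`: `Dⱼ·|x|`. [folklore] -/
def boxExpG (Dbox : Fin S.n → ℕ) (x : ℤ) : Fin S.n → ℕ := fun j => Dbox j * x.natAbs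

/-- In the box, `|vⱼ·x| ≤ Dⱼ·|x|`. [folklore] -/
theorem abs_mul_le_boxExpG {Dbox : Fin S.n → ℕ} {w : Fin S.n → ℤ} (hw : ∀ j, |w j| ≤ (Dbox j : ℤ)) (x : ℤ) (j : Fin S.n) :
    |w j * x| ≤ (S.boxExpG Dbox x j : ℤ) := by
  unfold boxExpG
  push_cast
  rw [abs_mul]
  exact mul_le_mul_of_nonneg_right (hw j) (abs_nonneg _)

/-- **The monomial cleared**: `monDen(α, D·|x|)·∏ⱼ αⱼ^{vⱼx} ∈ ℤ` with `|·| ≤ monDen²`. [cite: Nesterenko2003, §3.2; shape only] -/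
theorem exists_int_monDen_mul_prod {Dbox : Fin S.n → ℕ} {w : Fin S.n → ℤ} (hw : ∀ j, |w j| ≤ (Dbox j : ℤ)) (x : ℤ) :
    ∃ z : ℤ, ((MonomialDen.monDen S.α (S.boxExpG Dbox x) : ℕ) : ℚ) * ∏ j, S.α j ^ (w j * x) = z ∧
      |z| ≤ ((MonomialDen.monDen S.α (S.boxExpG Dbox x) : ℤ)) ^ 2 :=
  MonomialDen.exists_int_monDen_mul_prod_zpow S.α S.α_ne _ _ (S.abs_mul_le_boxExpG hw x)

/-! ### The directional monomial cleared by `b_{j₀}^{|t|}` -/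

/-- `b_{j₀}^{Σ tₖ}·zγpow = ∏ 𝔛ₖ^{tₖ}`. [folklore] -/
theorem bj₀_pow_mul_zγpow (i : ι) (t : Fin S.n → ℕ) :
    (S.b S.j₀ : ℚ) ^ (∑ k, t k) * S.zγpow v i t = ∏ k, (S.𝔛 (v i) k : ℚ) ^ t k := by
  have hb : (S.b S.j₀ : ℚ) ≠ 0 := by exact_mod_cast S.bj₀_ne
  unfold zγpow zγ
  rw [← Finset.prod_pow_eq_pow_sum, ← Finset.prod_mul_distrib]
  refine Finset.prod_congr rfl fun k _ => ?_
  rw [← mul_pow, mul_div_cancel₀ _ hb]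

/-- `|∏ 𝔛ₖ^{tₖ}| ≤ Xb^{Σ tₖ}` when `|𝔛ₖ| ≤ Xb`. [folklore] -/
theorem abs_prod_𝔛_pow_le (i : ι) (t : Fin S.n → ℕ) {Xb : ℤ} (hX : ∀ k, |S.𝔛 (v i) k| ≤ Xb) :
    |∏ k, S.𝔛 (v i) k ^ t k| ≤ Xb ^ (∑ k, t k) := by
  rw [Finset.abs_prod, ← Finset.prod_pow_eq_pow_sum]
  refine Finset.prod_le_prod (fun k _ => abs_nonneg _) fun k _ => ?_
  rw [abs_pow]
  exact pow_le_pow_left₀ (abs_nonneg _) (hX k) _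

/-! ### The value cleared, and the Liouville inequality -/

/-- **One coefficient cleared**: `D·[(Hasse_{t₀} Rᵢ)(x)·zγpow·∏αⱼ^{vⱼx}] ∈ ℤ`, `|·| ≤ M₀·Xb^{|t|}·monDen²`, `D = den₀·|b_{j₀}|^{|t|}·monDen`.
[cite: Yu2013, (5.35); shape only] -/
theorem exists_int_clear_mul_coef {Dbox : Fin S.n → ℕ} (i : ι) (hv : ∀ j, |v i j| ≤ (Dbox j : ℤ))
    (τ : Tau S.n) (x : ℤ) {den₀ : ℕ} {M₀ : ℤ}
    (hR : ∃ z₀ : ℤ, (den₀ : ℚ) * (hasseDeriv τ.1 (R i)).eval (x : ℚ) = z₀ ∧ |z₀| ≤ M₀)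
    {Xb : ℤ} (hX : ∀ k, |S.𝔛 (v i) k| ≤ Xb) :
    ∃ z : ℤ, ((den₀ * (S.b S.j₀).natAbs ^ (∑ k, τ.2 k) * MonomialDen.monDen S.α (S.boxExpG Dbox x) : ℕ) : ℚ) *
        ((hasseDeriv τ.1 (R i)).eval (x : ℚ) * S.zγpow v i τ.2 * ∏ j, S.α j ^ (v i j * x)) = z ∧
      |z| ≤ M₀ * Xb ^ (∑ k, τ.2 k) * ((MonomialDen.monDen S.α (S.boxExpG Dbox x) : ℤ)) ^ 2 := by
  obtain ⟨z₀, hz₀, hz₀le⟩ := hR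
  obtain ⟨z₂, hz₂, hz₂le⟩ := S.exists_int_monDen_mul_prod hv x
  set z₁ : ℤ := ∏ k, S.𝔛 (v i) k ^ τ.2 k with hz₁
  have hz₁q : (((S.b S.j₀).natAbs ^ (∑ k, τ.2 k) : ℕ) : ℚ) * S.zγpow v i τ.2 = ((S.b S.j₀).sign : ℚ) ^ (∑ k, τ.2 k) * z₁ := by
    have hsgn : (((S.b S.j₀).natAbs : ℕ) : ℚ) = ((S.b S.j₀).sign : ℚ) * S.b S.j₀ := by
      rw [Nat.cast_natAbs]; push_cast
      rw [← Int.cast_abs, ← Int.sign_mul_self_eq_abs]; push_cast; ring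
    push_cast
    rw [hsgn, mul_pow, mul_assoc, S.bj₀_pow_mul_zγpow, hz₁]
    push_cast; ring
  have hz₁le : |z₁| ≤ Xb ^ (∑ k, τ.2 k) := S.abs_prod_𝔛_pow_le v i τ.2 hX
  have hsgn1 : |((S.b S.j₀).sign : ℤ) ^ (∑ k, τ.2 k)| = 1 := by
    rw [abs_pow]
    have : |(S.b S.j₀).sign| = 1 := by
      rcases lt_or_gt_of_ne S.bj₀_ne with h | h
      · rw [Int.sign_eq_neg_one_of_neg h]; rfl
      · rw [Int.sign_eq_one_of_pos h]; rfl
    rw [this, one_pow]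
  refine ⟨z₀ * ((S.b S.j₀).sign ^ (∑ k, τ.2 k) * z₁) * z₂, ?_, ?_⟩
  · push_cast
    have e1 := hz₀
    have e2 := hz₁q
    have e3 := hz₂
    push_cast at e2 e3
    calc ((den₀ : ℚ) * (((S.b S.j₀).natAbs : ℕ) : ℚ) ^ (∑ k, τ.2 k) * (MonomialDen.monDen S.α (S.boxExpG Dbox x) : ℚ)) *
          ((hasseDeriv τ.1 (R i)).eval (x : ℚ) * S.zγpow v i τ.2 * ∏ j, S.α j ^ (v i j * x))
        = ((den₀ : ℚ) * (hasseDeriv τ.1 (R i)).eval (x : ℚ)) *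
          (((((S.b S.j₀).natAbs : ℕ) : ℚ) ^ (∑ k, τ.2 k)) * S.zγpow v i τ.2) *
          ((MonomialDen.monDen S.α (S.boxExpG Dbox x) : ℚ) * ∏ j, S.α j ^ (v i j * x)) := by ring
      _ = (z₀ : ℚ) * (((S.b S.j₀).sign : ℚ) ^ (∑ k, τ.2 k) * z₁) * z₂ := by rw [e1, e2, e3]
  · have h0 : (0 : ℤ) ≤ M₀ := (abs_nonneg _).trans hz₀le
    rw [abs_mul, abs_mul, abs_mul, hsgn1, one_mul]
    have hXb : (0 : ℤ) ≤ Xb ^ (∑ k, τ.2 k) := (abs_nonneg _).trans hz₁le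
    calc |z₀| * |z₁| * |z₂| ≤ M₀ * Xb ^ (∑ k, τ.2 k) * |z₂| := by
          refine mul_le_mul_of_nonneg_right ?_ (abs_nonneg _)
          exact mul_le_mul hz₀le hz₁le (abs_nonneg _) h0
      _ ≤ M₀ * Xb ^ (∑ k, τ.2 k) * ((MonomialDen.monDen S.α (S.boxExpG Dbox x) : ℤ)) ^ 2 :=
          mul_le_mul_of_nonneg_left hz₂le (mul_nonneg h0 hXb)

/-- **The value cleared**: `D·g3φ τ x ∈ ℤ` with `|·| ≤ #B·P·M₀·Xb^{|t|}·monDen²`. [cite: Yu2013, (5.35)–(5.39); shape only] -/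
theorem exists_int_clear_mul_g3φ {Dbox : Fin S.n → ℕ} (B : Finset ι) (pv : ι → ℤ)
    (hv : ∀ i ∈ B, ∀ j, |v i j| ≤ (Dbox j : ℤ)) (τ : Tau S.n) (x : ℤ) {den₀ : ℕ} {M₀ : ℤ}
    (hR : ∀ i ∈ B, ∃ z₀ : ℤ, (den₀ : ℚ) * (hasseDeriv τ.1 (R i)).eval (x : ℚ) = z₀ ∧ |z₀| ≤ M₀)
    {Xb : ℤ} (hX : ∀ i ∈ B, ∀ k, |S.𝔛 (v i) k| ≤ Xb) {P : ℤ} (hP : ∀ i ∈ B, |pv i| ≤ P) :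
    ∃ z : ℤ, ((den₀ * (S.b S.j₀).natAbs ^ (∑ k, τ.2 k) * MonomialDen.monDen S.α (S.boxExpG Dbox x) : ℕ) : ℚ) *
        S.g3φ R v B pv τ x = z ∧
      |z| ≤ B.card * P * (M₀ * Xb ^ (∑ k, τ.2 k) * ((MonomialDen.monDen S.α (S.boxExpG Dbox x) : ℤ)) ^ 2) := by
  classical
  have hcoef : ∀ i ∈ B, ∃ z : ℤ, ((den₀ * (S.b S.j₀).natAbs ^ (∑ k, τ.2 k) * MonomialDen.monDen S.α (S.boxExpG Dbox x) : ℕ) : ℚ) *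
        ((hasseDeriv τ.1 (R i)).eval (x : ℚ) * S.zγpow v i τ.2 * ∏ j, S.α j ^ (v i j * x)) = z ∧
      |z| ≤ M₀ * Xb ^ (∑ k, τ.2 k) * ((MonomialDen.monDen S.α (S.boxExpG Dbox x) : ℤ)) ^ 2 :=
    fun i hi => S.exists_int_clear_mul_coef R v i (hv i hi) τ x (hR i hi) (hX i hi)
  choose! z hz hzle using hcoef
  refine ⟨∑ i ∈ B, pv i * z i, ?_, ?_⟩
  · unfold g3φ
    rw [Finset.mul_sum]
    push_cast
    refine Finset.sum_congr rfl fun i hi => ?_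
    have h := hz i hi
    push_cast at h
    calc ((den₀ : ℚ) * (((S.b S.j₀).natAbs : ℕ) : ℚ) ^ (∑ k, τ.2 k) * (MonomialDen.monDen S.α (S.boxExpG Dbox x) : ℚ)) *
          ((pv i : ℚ) * (hasseDeriv τ.1 (R i)).eval (x : ℚ) * S.zγpow v i τ.2 * ∏ j, S.α j ^ (v i j * x))
        = (pv i : ℚ) * (((den₀ : ℚ) * (((S.b S.j₀).natAbs : ℕ) : ℚ) ^ (∑ k, τ.2 k) *
          (MonomialDen.monDen S.α (S.boxExpG Dbox x) : ℚ)) *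
          ((hasseDeriv τ.1 (R i)).eval (x : ℚ) * S.zγpow v i τ.2 * ∏ j, S.α j ^ (v i j * x))) := by ring
      _ = (pv i : ℚ) * (z i : ℚ) := by rw [h]
  · calc |∑ i ∈ B, pv i * z i| ≤ ∑ i ∈ B, |pv i * z i| := Finset.abs_sum_le_sum_abs _ _
      _ ≤ ∑ i ∈ B, P * (M₀ * Xb ^ (∑ k, τ.2 k) * ((MonomialDen.monDen S.α (S.boxExpG Dbox x) : ℤ)) ^ 2) := by
          refine Finset.sum_le_sum fun i hi => ?_
          rw [abs_mul]
          have hP0 : (0 : ℤ) ≤ P := (abs_nonneg _).trans (hP i hi)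
          exact mul_le_mul (hP i hi) (hzle i hi) (abs_nonneg _) hP0
      _ = B.card * P * (M₀ * Xb ^ (∑ k, τ.2 k) * ((MonomialDen.monDen S.α (S.boxExpG Dbox x) : ℤ)) ^ 2) := by
          rw [Finset.sum_const, nsmul_eq_mul]; ring

/-- **THE LIOUVILLE INEQUALITY AT THE INTEGER POINTS** (small ⇒ zero): if `‖g3φ τ x‖_p < 1/K` with
`K ≥ #B·P·M₀·Xb^{|t|}·monDen²`, then `g3φ τ x = 0`. [cite: Yu2013, (5.40)–(5.41); shape only] -/
theorem g3φ_eq_zero_of_norm_lt {Dbox : Fin S.n → ℕ} (B : Finset ι) (pv : ι → ℤ)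
    (hv : ∀ i ∈ B, ∀ j, |v i j| ≤ (Dbox j : ℤ)) (τ : Tau S.n) (x : ℤ) {den₀ : ℕ} (hden₀ : 1 ≤ den₀) {M₀ : ℤ}
    (hR : ∀ i ∈ B, ∃ z₀ : ℤ, (den₀ : ℚ) * (hasseDeriv τ.1 (R i)).eval (x : ℚ) = z₀ ∧ |z₀| ≤ M₀)
    {Xb : ℤ} (hX : ∀ i ∈ B, ∀ k, |S.𝔛 (v i) k| ≤ Xb) {P : ℤ} (hP : ∀ i ∈ B, |pv i| ≤ P)
    {K : ℝ} (hK : (B.card : ℝ) * P * (M₀ * (Xb : ℝ) ^ (∑ k, τ.2 k) * ((MonomialDen.monDen S.α (S.boxExpG Dbox x) : ℝ)) ^ 2) ≤ K)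
    (hK0 : 0 < K) (hlt : ‖((S.g3φ R v B pv τ x : ℚ) : ℚ_[p])‖ < 1 / K) :
    S.g3φ R v B pv τ x = 0 := by
  classical
  by_contra hne
  have hmon1 : 1 ≤ MonomialDen.monDen S.α (S.boxExpG Dbox x) := MonomialDen.one_le_monDen _ S.α_ne _
  have hb1 : 1 ≤ (S.b S.j₀).natAbs := Int.natAbs_pos.mpr S.bj₀_ne
  set D : ℕ := den₀ * (S.b S.j₀).natAbs ^ (∑ k, τ.2 k) * MonomialDen.monDen S.α (S.boxExpG Dbox x) with hDdef
  have hD1 : 1 ≤ D := one_le_mul (one_le_mul hden₀ (Nat.one_le_pow _ _ hb1)) hmon1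
  obtain ⟨z, hz, hzle⟩ := S.exists_int_clear_mul_g3φ R v B pv hv τ x hR hX hP
  have hDpos : (0 : ℝ) < (D : ℝ) := by exact_mod_cast (show 0 < D by omega)
  have hφ : |((S.g3φ R v B pv τ x : ℚ) : ℝ)| ≤ K / (D : ℝ) := by
    rw [le_div_iff₀ hDpos]
    have h2 : (D : ℝ) * ((S.g3φ R v B pv τ x : ℚ) : ℝ) = (z : ℝ) := by
      have := congrArg (fun q : ℚ => (q : ℝ)) hz
      rw [hDdef]
      push_cast at this ⊢
      exact this
    have h1 : |((S.g3φ R v B pv τ x : ℚ) : ℝ)| * (D : ℝ) = |(z : ℝ)| := by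
      rw [← h2, abs_mul, Nat.abs_cast, mul_comm]
    rw [h1]
    have hzR : |(z : ℝ)| ≤ (B.card : ℝ) * P * (M₀ * (Xb : ℝ) ^ (∑ k, τ.2 k) * ((MonomialDen.monDen S.α (S.boxExpG Dbox x) : ℝ)) ^ 2) := by
      have := (Int.cast_le (R := ℝ)).mpr hzle
      push_cast at this
      linarith
    exact hzR.trans hK
  have hge := SetupQ.padicNorm_ge_of_int_mul (p := p) hne hD1 ⟨z, hz⟩ hφ
  have hKD : (D : ℝ) * (K / (D : ℝ)) = K := by field_simp
  rw [hKD] at hge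
  exact absurd hge (not_le.mpr hlt)

/-! ### The k-step -/

/-- **The `p`-adic k-step of the odd Gen-3 frame on the slab** (twin of `PadicG3TwoKStep.g3_kstep` / M2 `padic_kstep`).  On a twist class
with relative depth-`m+1` exponents in the box `|vᵢⱼ| ≤ Dⱼ`: if the rational values `g3φ τ'' x` vanish for `|x| ≤ N`, `|τ''| < Tlo`, the
`Y₀`-weights satisfy the weighted bound `Bw` at radius `p^m√p`, `‖Λ/b_{j₀}‖ ≤ p⁻¹`, the record's Liouville datum at the new points is
`K(x₁, τ) ≥ #B·P·M₀·Xb^{|t|}·monDen²`, and `max (Bw·‖Λ/b_{j₀}‖·p^{⌊(t−1)/2⌋}·p^{condExp}) (Bw/(p^m√p)^{(2N+1)t}) < 1/K(x₁, τ)`, then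
`g3φ τ x₁ = 0` for `|x₁| ≤ N'`, `|τ| + t ≤ Tlo`. [cite: Yu2013, Lemma 5.2] [cite: Yu1999, §10] -/
theorem g3_kstep (m : ℕ) (B : Finset ι) (hB : ∀ i ∈ B, ‖S.E (v i)‖ ≤ (p : ℝ)⁻¹ ^ (m + 1))
    (hcls : ∀ i ∈ B, S.cls (v i) = 1) (pv : ι → ℤ) {N N' Tlo t : ℕ} (ht : 1 ≤ t)
    {Bw : ℝ} (hBw0 : 0 ≤ Bw) (hBw : ∀ i ∈ B, ∀ t₀ k, ‖(hw (p := p) R i t₀).coeff k‖ * ((p : ℝ) ^ m * Real.sqrt p) ^ k ≤ Bw)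
    (hΛ : ‖S.Λ / (S.b S.j₀ : ℚ_[p])‖ ≤ (p : ℝ)⁻¹)
    (hzero : ∀ x : ℤ, |x| ≤ (N : ℤ) → ∀ τ'' : Tau S.n, tauNorm τ'' < Tlo → S.g3φ R v B pv τ'' x = 0)
    {Dbox : Fin S.n → ℕ} (hv : ∀ i ∈ B, ∀ j, |v i j| ≤ (Dbox j : ℤ))
    (den₀ : ℤ → Tau S.n → ℕ) (hden₀ : ∀ x τ, 1 ≤ den₀ x τ) {M₀ : ℤ}
    (hR : ∀ (x : ℤ) (τ : Tau S.n), ∀ i ∈ B, ∃ z₀ : ℤ, (den₀ x τ : ℚ) * (hasseDeriv τ.1 (R i)).eval (x : ℚ) = z₀ ∧ |z₀| ≤ M₀)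
    {Xb : ℤ} (hX : ∀ i ∈ B, ∀ k, |S.𝔛 (v i) k| ≤ Xb) {P : ℤ} (hP : ∀ i ∈ B, |pv i| ≤ P)
    (K : ℤ → Tau S.n → ℝ) (hK0 : ∀ x τ, 0 < K x τ)
    (hK : ∀ (x : ℤ) (τ : Tau S.n), (B.card : ℝ) * P * (M₀ * (Xb : ℝ) ^ (∑ k, τ.2 k) *
      ((MonomialDen.monDen S.α (S.boxExpG Dbox x) : ℝ)) ^ 2) ≤ K x τ)
    (hfinal : ∀ x₁ : ℤ, |x₁| ≤ (N' : ℤ) → ∀ τ : Tau S.n, tauNorm τ + t ≤ Tlo →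
      max (Bw * ‖S.Λ / (S.b S.j₀ : ℚ_[p])‖ * (p : ℝ) ^ ((t - 1) / 2) * (p : ℝ) ^ condExp p (2 * N + 1) t)
        (Bw / ((p : ℝ) ^ m * Real.sqrt p) ^ ((2 * N + 1) * t)) < 1 / K x₁ τ) :
    ∀ x₁ : ℤ, |x₁| ≤ (N' : ℤ) → ∀ τ : Tau S.n, tauNorm τ + t ≤ Tlo → S.g3φ R v B pv τ x₁ = 0 := by
  intro x₁ hx₁ τ hτ
  have hz : ‖((x₁ : ℤ) : ℚ_[p])‖ ≤ 1 := Padic.norm_int_le_one (p := p) x₁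
  have hcore := (S.norm_g3F_le_of_zeros R v m B hB hcls pv ht hBw0 hBw hΛ hzero hz τ hτ).2
  rw [S.g3Φ_intCast R v B hcls] at hcore
  exact S.g3φ_eq_zero_of_norm_lt R v B pv hv τ x₁ (hden₀ x₁ τ) (hR x₁ τ) hX hP (hK x₁ τ) (hK0 x₁ τ)
    (lt_of_le_of_lt hcore (hfinal x₁ hx₁ τ hτ))

/-- **The k-step with POINTWISE weight sizes** (`M₀ x τ` instead of one `M₀`; answers p5-g3's (D1) 2026-08-27T00:42Z: the uniform
form is sound but wasteful for Fel'dman's `Δ(Y₀; ℓ₀, H)`, whose cleared Hasse derivatives at `x` have size `≍ (e(1+|x|/H))^{ℓ₀}`).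
Same proof. [cite: Yu2013, Lemma 5.2] [cite: Yu1999, §10] -/
theorem g3_kstep_pt (m : ℕ) (B : Finset ι) (hB : ∀ i ∈ B, ‖S.E (v i)‖ ≤ (p : ℝ)⁻¹ ^ (m + 1))
    (hcls : ∀ i ∈ B, S.cls (v i) = 1) (pv : ι → ℤ) {N N' Tlo t : ℕ} (ht : 1 ≤ t)
    {Bw : ℝ} (hBw0 : 0 ≤ Bw) (hBw : ∀ i ∈ B, ∀ t₀ k, ‖(hw (p := p) R i t₀).coeff k‖ * ((p : ℝ) ^ m * Real.sqrt p) ^ k ≤ Bw)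
    (hΛ : ‖S.Λ / (S.b S.j₀ : ℚ_[p])‖ ≤ (p : ℝ)⁻¹)
    (hzero : ∀ x : ℤ, |x| ≤ (N : ℤ) → ∀ τ'' : Tau S.n, tauNorm τ'' < Tlo → S.g3φ R v B pv τ'' x = 0)
    {Dbox : Fin S.n → ℕ} (hv : ∀ i ∈ B, ∀ j, |v i j| ≤ (Dbox j : ℤ))
    (den₀ : ℤ → Tau S.n → ℕ) (hden₀ : ∀ x τ, 1 ≤ den₀ x τ) (M₀ : ℤ → Tau S.n → ℤ)
    (hR : ∀ (x : ℤ) (τ : Tau S.n), ∀ i ∈ B, ∃ z₀ : ℤ, (den₀ x τ : ℚ) * (hasseDeriv τ.1 (R i)).eval (x : ℚ) = z₀ ∧ |z₀| ≤ M₀ x τ)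
    {Xb : ℤ} (hX : ∀ i ∈ B, ∀ k, |S.𝔛 (v i) k| ≤ Xb) {P : ℤ} (hP : ∀ i ∈ B, |pv i| ≤ P)
    (K : ℤ → Tau S.n → ℝ) (hK0 : ∀ x τ, 0 < K x τ)
    (hK : ∀ (x : ℤ) (τ : Tau S.n), (B.card : ℝ) * P * (M₀ x τ * (Xb : ℝ) ^ (∑ k, τ.2 k) *
      ((MonomialDen.monDen S.α (S.boxExpG Dbox x) : ℝ)) ^ 2) ≤ K x τ)
    (hfinal : ∀ x₁ : ℤ, |x₁| ≤ (N' : ℤ) → ∀ τ : Tau S.n, tauNorm τ + t ≤ Tlo →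
      max (Bw * ‖S.Λ / (S.b S.j₀ : ℚ_[p])‖ * (p : ℝ) ^ ((t - 1) / 2) * (p : ℝ) ^ condExp p (2 * N + 1) t)
        (Bw / ((p : ℝ) ^ m * Real.sqrt p) ^ ((2 * N + 1) * t)) < 1 / K x₁ τ) :
    ∀ x₁ : ℤ, |x₁| ≤ (N' : ℤ) → ∀ τ : Tau S.n, tauNorm τ + t ≤ Tlo → S.g3φ R v B pv τ x₁ = 0 := by
  intro x₁ hx₁ τ hτ
  have hz : ‖((x₁ : ℤ) : ℚ_[p])‖ ≤ 1 := Padic.norm_int_le_one (p := p) x₁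
  have hcore := (S.norm_g3F_le_of_zeros R v m B hB hcls pv ht hBw0 hBw hΛ hzero hz τ hτ).2
  rw [S.g3Φ_intCast R v B hcls] at hcore
  exact S.g3φ_eq_zero_of_norm_lt R v B pv hv τ x₁ (hden₀ x₁ τ) (hR x₁ τ) hX hP (hK x₁ τ) (hK0 x₁ τ)
    (lt_of_le_of_lt hcore (hfinal x₁ hx₁ τ hτ))

end G3Setup

end Summit.ABC.StewartYu

end
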